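import Summits.KontsevichZagierPeriods.Zeta5Search.LaiSweepShard

/-!
# `κ₃` sweep certificate — shard file 120 of 127 (shards 840–846 of 889)

HONEST FRAMING. Systematic search; no irrationality claim unless certified. This file only checks,
by `decide +kernel`, shards 840–846 of the order-cell sweep of the `κ₃` point `(74, 2180, 444; δ74)`
(engine `LaiSweepEngine`, soundness `LaiSweepJump/Free/Eval/Shard/Kappa3`; a shard is `⟨regime, n,
p, q, p', q', Lo, Up⟩`: `n` cells from `p/q` to `p'/q'` with integer rate sums in `[Lo, Up]`, `K =
128`, `D = 2^40`). It draws NO conclusion: only the capstone `LaiKappa3SweepCert`, which needs all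
127 shard files, does. Kernel cost of this file ≈ 560 cells × 0.3 s.
-/

namespace Summit.KontsevichZagierPeriods.Zeta5Search.Sweep

set_option maxHeartbeats 100000000 in
/-- Shard 840: 80 cells of regime B from `261/278` to `267/284`.
[cite: Lai2024BallRivoal, §4 Lemma 4.3] -/
theorem shard840 :
    Shard.check 128 (2^40)
      ⟨true, 80, 261, 278, 267, 284, 10521207647387, 18358678696580⟩ = true := by
  decide +kernel

set_option maxHeartbeats 100000000 in
/-- Shard 841: 80 cells of regime B from `267/284` to `209/222`.
[cite: Lai2024BallRivoal, §4 Lemma 4.3] -/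
theorem shard841 :
    Shard.check 128 (2^40)
      ⟨true, 80, 267, 284, 209, 222, 10585570323861, 18490596642728⟩ = true := by
  decide +kernel

set_option maxHeartbeats 100000000 in
/-- Shard 842: 80 cells of regime B from `209/222` to `411/436`.
[cite: Lai2024BallRivoal, §4 Lemma 4.3] -/
theorem shard842 :
    Shard.check 128 (2^40)
      ⟨true, 80, 209, 222, 411, 436, 9916655069108, 17339876681676⟩ = true := by
  decide +kernel

set_option maxHeartbeats 100000000 in
/-- Shard 843: 80 cells of regime B from `411/436` to `286/303`.
[cite: Lai2024BallRivoal, §4 Lemma 4.3] -/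
theorem shard843 :
    Shard.check 128 (2^40)
      ⟨true, 80, 411, 436, 286, 303, 10029224075133, 17554281704201⟩ = true := by
  decide +kernel

set_option maxHeartbeats 100000000 in
/-- Shard 844: 80 cells of regime B from `286/303` to `293/310`.
[cite: Lai2024BallRivoal, §4 Lemma 4.3] -/
theorem shard844 :
    Shard.check 128 (2^40)
      ⟨true, 80, 286, 303, 293, 310, 10289557131472, 18028386841643⟩ = true := by
  decide +kernel

set_option maxHeartbeats 100000000 in
/-- Shard 845: 80 cells of regime B from `293/310` to `406/429`.
[cite: Lai2024BallRivoal, §4 Lemma 4.3] -/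
theorem shard845 :
    Shard.check 128 (2^40)
      ⟨true, 80, 293, 310, 406, 429, 9947572702349, 17446827816723⟩ = true := by
  decide +kernel

set_option maxHeartbeats 100000000 in
/-- Shard 846: 80 cells of regime B from `406/429` to `181/191`.
[cite: Lai2024BallRivoal, §4 Lemma 4.3] -/
theorem shard846 :
    Shard.check 128 (2^40)
      ⟨true, 80, 406, 429, 181, 191, 10199152531669, 17906229272765⟩ = true := by
  decide +kernel

/-- The checked shards of this file, in order. [folklore] -/
def shards120 : List (CheckedShard 128 (2^40)) :=
  [⟨_, shard840⟩, ⟨_, shard841⟩, ⟨_, shard842⟩, ⟨_, shard843⟩, ⟨_, shard844⟩,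
    ⟨_, shard845⟩, ⟨_, shard846⟩]

end Summit.KontsevichZagierPeriods.Zeta5Search.Sweep
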